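import Summits.BirchSwinnertonDyer.BirchSwinnertonDyer.Theorems.ManinLocalTwoThreeVeluFiveKummerLemma
import Literature.NumberTheory.EllipticCurves.IsogenyQuotientCurveProofs
import Literature.NumberTheory.EllipticCurves.IsogenyQuotientUniqueProofs
import Literature.NumberTheory.EllipticCurves.IsogenyVariableChangeProofs
import Literature.NumberTheory.EllipticCurves.IsogenyCompProofs
import Literature.NumberTheory.EllipticCurves.GaloisActionProofs
import Literature.NumberTheory.EllipticCurves.SelmerCorankProofs
import Literature.NumberTheory.GaloisRepresentations.CyclotomicCharacterSurjectiveProofs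
import HarnessLib

/-!
# Road δ, part 8: E-es-241 `SplitFiveTorsionIsVeluQuotient` is a theorem

**Statement (row E-es-241 of the node `ShimuraFiveModuli`).**  Let `E/ℚ` be an elliptic curve with a rational point
`t` of order `5` whose `5`-torsion is *split*: `Gal(ℚ̄/ℚ(μ₅))` acts trivially on `E[5]`.  Then `E ≅ veluFive b`
over `ℚ` for some `b ∈ ℚ`, where `veluFive b = E'_{b,1} = E_{b,1}/⟨(0,0)⟩` is Vélu's quotient of the Tate normal
form (`veluFive_eq_kubertTateFive'`).

## Proof

1. **An abelian image.**  Under the split hypothesis `Γ_ℚ` acts on `E[5]` through `Gal(ℚ(μ₅)/ℚ)`, an abelian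
   group: a commutator `στσ⁻¹τ⁻¹` fixes `μ₅(ℚ̄)` (two automorphisms act on the cyclic group `μ₅` by power maps,
   which commute), hence fixes `E[5]`; so `στ = τσ` on `E[5]` (`smul_smul_comm_of_split`).
2. **A stable complement.**  Let `T̄ = ι t ∈ E[5]` (fixed, order `5`) and let `σ₀ ∈ Γ_ℚ` act on `μ₅` by `ζ ↦ ζ²`
   (tree `RootOfUnityAction.exists_smul_eq_pow_and_smul_eq_self`, `Φ₅` irreducible over `ℚ`).  In a Weil frame
   `(T̄, U)` (tree `weilPairingFun_frame`: `E[5] = ℕT̄ + ℕU`, `e₅(S, T̄) = εᵇ` for `S = aT̄ + bU`, `ε` primitive),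
   `σ₀U = aT̄ + dU` with `εᵈ = e₅(σ₀U, T̄) = e₅(σ₀U, σ₀T̄) = σ₀ε = ε²`, so `d = 2`; then `U' = aT̄ + U` satisfies
   `σ₀U' = 2U'`.  The line `C = ⟨U'⟩` has order `5`, misses `T̄` (`T̄ = kU'` would give `T̄ = σ₀T̄ = 2T̄`), and is
   `Γ_ℚ`-stable: for `σ ∈ Γ_ℚ`, `σ₀(σU') = σ(σ₀U') = 2σU'` by Step 1, and the `2`-eigenvectors of `σ₀` in
   `E[5] = ⟨T̄⟩ ⊕ ⟨U'⟩` are the multiples of `U'` (`exists_stable_complement`).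
3. **The quotient.**  `g : E → E' = E/C` with dual `f`, `fg = [5]` (tree `exists_isogeny_ker_eq_and_comp_eq_nsmul_holds`);
   `gT̄ ∈ E'(ℚ̄)` is fixed, hence rational (`t' ∈ E'(ℚ)`, tree `exists_toGeomPoints_eq_of_forall_smul_eq`), of order
   `5`, and `ker f = g(E[5]) = ⟨gT̄⟩`.
4. **Tate normal form of `(E', t')`**: `C₁ • E' = E_{b,1}` (tree
   `exists_variableChange_eq_kubertTate_self_of_addOrderOf_eq_five'`).  On `E_{b,1}` every `Γ_ℚ`-fixed `5`-torsion
   point lies in `⟨T̄_{b}⟩` (`ζ = e₅(P, T̄_b)` is fixed by `σ₀`, so `ζ² = ζ`, `ζ = 1`; non-degeneracy), so the isogeny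
   `f ∘ (E_{b,1} ≅ E') : E_{b,1} → E` has kernel `⟨T̄_b⟩ = ker φ_b` (Vélu, tree `ker_fiveIsogeny_eq_zmultiples`).
5. **Uniqueness of the quotient** (tree `Isogeny.exists_variableChange_eq_of_ker_eq`, Silverman III.4.12):
   `E ≅ E'_{b,1} = veluFive b` over `ℚ`.

With E-es-242 (`veluFiveRationalFiveTorsion_holds`, part 7) this closes E-es-239 `SplitFiveTorsionModuli` and the
last load-bearing row L5 `SplitFiveTorsionRootNumberLaw` of the C2 programme at the prime `5`
(`splitFiveTorsionRootNumberLaw_of_split`).  BSD is not proved here; C2/C3 remain OPEN ⟸ CDT.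

References: Silverman, *AEC* (2009), III.4.12, III.6.1–6.2, III.8.1, VIII.§1; Knapp (1993) V.5 (5.31);
Kubert (1976) Table 3; Vélu (1971); Washington, *Cyclotomic Fields*, Thm. 2.5; Fisher (2001) §1.
-/

set_option linter.dupNamespace false

noncomputable section

open scoped Classical

universe u

namespace Summit.BirchSwinnertonDyer.BirchSwinnertonDyer.Theorems.ManinLocalTwoThree.ShimuraFive

open WeierstrassCurve WeierstrassCurve.geomPoints WeierstrassCurve.Isogeny Field
  Literature.NumberTheory.EllipticCurves Literature.NumberTheory.EllipticCurves.WeierstrassFunctionField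
  Literature.NumberTheory.EllipticCurves.KubertTateKummer Literature.NumberTheory.EllipticCurves.KubertTateVelu
  Literature.NumberTheory.GaloisRepresentations
  Summit.BirchSwinnertonDyer.Rank1Residual.ManinAdditive
  Summit.BirchSwinnertonDyer.Rank1Residual.ManinAdditive.EsG43
  Summit.BirchSwinnertonDyer.Rank1Residual.ManinAdditive.EsG44

/-! ## §1 `Γ_ℚ` acts on `μ₅(ℚ̄)` through an abelian group -/

/-- Two elements of `Γ_ℚ` commute on `μ₅(ℚ̄)` (both act on the cyclic group `μ₅` by power maps).
[cite: Washington1997, Thm. 2.5] -/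
theorem smul_smul_comm_of_pow_five_eq_one (σ τ : absoluteGaloisGroup ℚ) {ζ : AlgebraicClosure ℚ}
    (hζ : ζ ^ 5 = 1) : σ • τ • ζ = τ • σ • ζ := by
  haveI : Fact (Nat.Prime 5) := ⟨Nat.prime_five⟩
  by_cases h1 : ζ = 1
  · subst h1; rw [smul_one, smul_one, smul_one]
  · have hprim : IsPrimitiveRoot ζ 5 := by
      have h := IsPrimitiveRoot.orderOf ζ
      rwa [orderOf_eq_prime hζ h1] at h
    have hσ5 : (σ • ζ) ^ 5 = 1 := by rw [← smul_pow', hζ, smul_one]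
    have hτ5 : (τ • ζ) ^ 5 = 1 := by rw [← smul_pow', hζ, smul_one]
    obtain ⟨a, -, ha⟩ := hprim.eq_pow_of_pow_eq_one hσ5
    obtain ⟨b, -, hb⟩ := hprim.eq_pow_of_pow_eq_one hτ5
    rw [← hb, smul_pow', ← ha, ← pow_mul, smul_pow', ← hb, ← pow_mul, mul_comm]

/-- A commutator in `Γ_ℚ` fixes `μ₅(ℚ̄)` pointwise. [cite: Washington1997, Thm. 2.5] -/
theorem commutator_smul_eq_self (σ τ : absoluteGaloisGroup ℚ) {ζ : AlgebraicClosure ℚ} (hζ : ζ ^ 5 = 1) :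
    (σ * τ * σ⁻¹ * τ⁻¹) • ζ = ζ := by
  have hξ : (σ⁻¹ • τ⁻¹ • ζ) ^ 5 = 1 := by rw [← smul_pow', ← smul_pow', hζ, smul_one, smul_one]
  rw [mul_smul, mul_smul, mul_smul, smul_smul_comm_of_pow_five_eq_one σ τ hξ, smul_inv_smul, smul_inv_smul]

/-- There is `σ₀ ∈ Γ_ℚ` acting on `μ₅(ℚ̄)` by `ζ ↦ ζ²` (`Φ₅` is irreducible over `ℚ`, so `Gal(ℚ(μ₅)/ℚ) = (ℤ/5)ˣ`).
[cite: Washington1997, Thm. 2.5] -/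
theorem exists_smul_eq_pow_two :
    ∃ σ₀ : absoluteGaloisGroup ℚ, ∀ ζ : AlgebraicClosure ℚ, ζ ^ 5 = 1 → σ₀ • ζ = ζ ^ 2 := by
  haveI : NeZero (5 : ℕ) := ⟨by norm_num⟩
  haveI : NeZero (1 : ℕ) := ⟨one_ne_zero⟩
  have hirr : Irreducible (Polynomial.cyclotomic (5 * 1) ℚ) := by
    simpa using Polynomial.cyclotomic.irreducible_rat (n := 5) (by norm_num)
  have hcop : Nat.Coprime 2 5 := by decide
  obtain ⟨σ, hσ, -⟩ := RootOfUnityAction.exists_smul_eq_pow_and_smul_eq_self (K := ℚ) (A := 5) (B := 1)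
    (Nat.coprime_one_right 5) hirr (ZMod.unitOfCoprime 2 hcop)
  have hval : ((ZMod.unitOfCoprime 2 hcop : (ZMod 5)ˣ) : ZMod 5).val = 2 := by
    rw [ZMod.coe_unitOfCoprime, ZMod.val_natCast]
  exact ⟨σ, fun ζ hζ ↦ by rw [hσ ζ hζ, hval]⟩

/-! ## §2 The split hypothesis: commuting action and a stable complement of `⟨T̄⟩` in `E[5]` -/

section Split

variable {W : WeierstrassCurve ℚ}

/-- **Step 1.** Under the split hypothesis (pointwise form: every `σ` fixing `μ₅(ℚ̄)` fixes `E[5]`) two elements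
of `Γ_ℚ` commute on `E[5]` (their commutator fixes `μ₅`, hence `E[5]`). [cite: SilvermanAEC2009, III.§7–§8] -/
theorem smul_smul_comm_of_split
    (hsplit : ∀ σ : absoluteGaloisGroup ℚ, (∀ ζ : AlgebraicClosure ℚ, ζ ^ 5 = 1 → σ • ζ = ζ) →
      ∀ P : W.geomPoints, ((5 : ℕ) : ℤ) • P = 0 → σ • P = P)
    (σ τ : absoluteGaloisGroup ℚ) {P : W.geomPoints} (hP : ((5 : ℕ) : ℤ) • P = 0) :
    σ • τ • P = τ • σ • P := by
  have hQ : ((5 : ℕ) : ℤ) • (τ • σ • P) = 0 := by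
    rw [smul_comm ((5 : ℕ) : ℤ) τ (σ • P), smul_comm ((5 : ℕ) : ℤ) σ P, hP, smul_zero, smul_zero]
  have h := hsplit (σ * τ * σ⁻¹ * τ⁻¹) (fun ζ hζ ↦ commutator_smul_eq_self σ τ hζ) (τ • σ • P) hQ
  rw [mul_smul, mul_smul, mul_smul, inv_smul_smul, inv_smul_smul] at h
  exact h

/-- **Step 2: a `Γ_ℚ`-stable complement of `⟨T̄⟩` in `E[5]`.**  For a non-zero `Γ_ℚ`-fixed `T̄ ∈ E[5]` on an
elliptic curve with split `5`-torsion there is `U' ∈ E[5]`, `U' ≠ O`, with `T̄ ∉ ⟨U'⟩`, `Γ_ℚ ⟨U'⟩ ⊆ ⟨U'⟩` and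
`E[5] = ⟨T̄⟩ + ℕU'` (the `χ₅`-eigenline of a `σ₀` with `χ₅(σ₀) = 2`, found with the Weil pairing).
[cite: SilvermanAEC2009, Prop. III.8.1] [cite: Washington1997, Thm. 2.5] -/
theorem exists_stable_complement [W.IsElliptic]
    (hsplit : ∀ σ : absoluteGaloisGroup ℚ, (∀ ζ : AlgebraicClosure ℚ, ζ ^ 5 = 1 → σ • ζ = ζ) →
      ∀ P : W.geomPoints, ((5 : ℕ) : ℤ) • P = 0 → σ • P = P)
    {T₀ : W.geomPoints} (hT : ((5 : ℕ) : ℤ) • T₀ = 0) (hT0 : T₀ ≠ 0)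
    (hTfix : ∀ σ : absoluteGaloisGroup ℚ, σ • T₀ = T₀) :
    ∃ U' : W.geomPoints, ((5 : ℕ) : ℤ) • U' = 0 ∧ U' ≠ 0 ∧ T₀ ∉ AddSubgroup.zmultiples U' ∧
      (∀ σ : absoluteGaloisGroup ℚ, σ • U' ∈ AddSubgroup.zmultiples U') ∧
      ∀ S : W.geomPoints, ((5 : ℕ) : ℤ) • S = 0 →
        ∃ y ∈ AddSubgroup.zmultiples T₀, ∃ b : ℕ, S = y + b • U' := by
  haveI : Fact (Nat.Prime 5) := ⟨Nat.prime_five⟩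
  set h5 := natCast_level_ne_zero ℚ 5 with hh5
  obtain ⟨U, hU, hprim, hframe⟩ := weilPairingFun_frame hT hT0
  set ε := weilPairingFun h5 U T₀ with hε
  obtain ⟨σ₀, hσ₀⟩ := exists_smul_eq_pow_two
  have hfixT : ∀ (σ : absoluteGaloisGroup ℚ) (y : W.geomPoints), y ∈ AddSubgroup.zmultiples T₀ →
      σ • y = y := by
    intro σ y hy
    obtain ⟨k, rfl⟩ := AddSubgroup.mem_zmultiples_iff.mp hy
    rw [smul_comm σ k T₀, hTfix]
  -- σ₀ U = a T̄ + 2 U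
  have hσU : ((5 : ℕ) : ℤ) • (σ₀ • U) = 0 := by rw [smul_comm ((5 : ℕ) : ℤ) σ₀ U, hU, smul_zero]
  obtain ⟨a, d, hd, hdec, hpair⟩ := hframe (σ₀ • U) hσU
  have hε5 : ε ^ 5 = 1 := hprim.pow_eq_one
  have hpair' : weilPairingFun h5 (σ₀ • U) T₀ = ε ^ 2 := by
    have h1 : weilPairingFun h5 (σ₀ • U) (σ₀ • T₀) = σ₀ • ε := weilPairingFun_smul h5 σ₀ hU hT
    rw [hTfix σ₀] at h1
    rw [h1, hσ₀ ε hε5]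
  have hd2 : d = 2 := hprim.pow_inj hd (by norm_num) (hpair.symm.trans hpair')
  rw [hd2] at hdec
  -- the eigenvector U' = a T̄ + U
  have haT : ((5 : ℕ) : ℤ) • (a • T₀) = 0 := by rw [smul_comm ((5 : ℕ) : ℤ) a T₀, hT, smul_zero]
  have hU'5 : ((5 : ℕ) : ℤ) • (a • T₀ + U) = 0 := by rw [smul_add, haT, hU, add_zero]
  have hσU' : σ₀ • (a • T₀ + U) = 2 • (a • T₀ + U) := by
    rw [smul_add, hdec, smul_comm σ₀ a T₀, hTfix]; abel
  have hεU' : weilPairingFun h5 (a • T₀ + U) T₀ = ε := by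
    rw [weilPairingFun_add_left h5 haT hU hT, weilPairingFun_nsmul_self hT a, one_mul]
  have hU'0 : a • T₀ + U ≠ 0 := by
    intro h0
    have : ε = 1 := by rw [← hεU', h0, weilPairingFun_zero_left h5 hT]
    exact hprim.ne_one (by norm_num) this
  have hUeq : U = (a • T₀ + U) - a • T₀ := by abel
  refine ⟨a • T₀ + U, hU'5, hU'0, ?_, ?_, ?_⟩
  · -- T̄ ∉ ⟨U'⟩ : else T̄ = σ₀ T̄ = 2 T̄
    intro hmem
    obtain ⟨k, hk⟩ := AddSubgroup.mem_zmultiples_iff.mp hmem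
    have h2 : 2 • T₀ = T₀ := by
      calc 2 • T₀ = 2 • k • (a • T₀ + U) := by rw [hk]
        _ = k • σ₀ • (a • T₀ + U) := by rw [hσU', smul_comm (2 : ℕ) k]
        _ = σ₀ • k • (a • T₀ + U) := (smul_comm σ₀ k _).symm
        _ = σ₀ • T₀ := by rw [hk]
        _ = T₀ := hTfix σ₀
    rw [two_nsmul, add_eq_left] at h2
    exact hT0 h2
  · -- stability
    intro σ
    have hQ5 : ((5 : ℕ) : ℤ) • (σ • (a • T₀ + U)) = 0 := by
      rw [smul_comm ((5 : ℕ) : ℤ) σ, hU'5, smul_zero]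
    have hcomm : σ₀ • σ • (a • T₀ + U) = 2 • σ • (a • T₀ + U) := by
      rw [smul_smul_comm_of_split hsplit σ₀ σ hU'5, hσU', smul_comm σ (2 : ℕ)]
    obtain ⟨a', b', -, hdec', -⟩ := hframe (σ • (a • T₀ + U)) hQ5
    have hymem : a' • T₀ - b' • (a • T₀) ∈ AddSubgroup.zmultiples T₀ :=
      sub_mem (AddSubgroup.nsmul_mem _ (AddSubgroup.mem_zmultiples T₀) a')
        (AddSubgroup.nsmul_mem _ (AddSubgroup.nsmul_mem _ (AddSubgroup.mem_zmultiples T₀) a) b')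
    have hdec'' : σ • (a • T₀ + U) = (a' • T₀ - b' • (a • T₀)) + b' • (a • T₀ + U) := by
      rw [hdec']
      conv_lhs => rw [hUeq]
      rw [nsmul_sub]; abel
    have hyfix : σ₀ • (a' • T₀ - b' • (a • T₀)) = a' • T₀ - b' • (a • T₀) := hfixT σ₀ _ hymem
    rw [hdec'', smul_add σ₀ (a' • T₀ - b' • (a • T₀)) (b' • (a • T₀ + U)),
      smul_add (2 : ℕ) (a' • T₀ - b' • (a • T₀)) (b' • (a • T₀ + U)), hyfix,
      smul_comm σ₀ b' (a • T₀ + U), hσU', smul_comm b' (2 : ℕ) (a • T₀ + U)] at hcomm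
    have hY : a' • T₀ - b' • (a • T₀) = 2 • (a' • T₀ - b' • (a • T₀)) := add_right_cancel hcomm
    have hY0 : a' • T₀ - b' • (a • T₀) = 0 := by
      rw [two_nsmul] at hY
      exact add_eq_left.mp hY.symm
    rw [hdec'', hY0, zero_add]
    exact AddSubgroup.nsmul_mem _ (AddSubgroup.mem_zmultiples _) b'
  · -- decomposition E[5] = ⟨T̄⟩ + ℕ U'
    intro S hS
    obtain ⟨a', b', -, hdecS, -⟩ := hframe S hS
    refine ⟨a' • T₀ - b' • (a • T₀), ?_, b', ?_⟩
    · exact sub_mem (AddSubgroup.nsmul_mem _ (AddSubgroup.mem_zmultiples T₀) a')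
        (AddSubgroup.nsmul_mem _ (AddSubgroup.nsmul_mem _ (AddSubgroup.mem_zmultiples T₀) a) b')
    · rw [hdecS]
      conv_lhs => rw [hUeq]
      rw [nsmul_sub]; abel

end Split

/-! ## §3 Fixed `5`-torsion on the Tate normal form lies on the kernel line -/

/-- On `E_{b,1}` every `Γ_ℚ`-fixed point of `E[5]` lies in `⟨T̄⟩`, `T̄ = (0,0)`: `ζ = e₅(P, T̄)` is `Γ_ℚ`-fixed, in
particular fixed by a `σ₀` squaring fifth roots of unity, so `ζ² = ζ`, `ζ = 1`; non-degeneracy.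
[cite: SilvermanAEC2009, Prop. III.8.1] [cite: Washington1997, Thm. 2.5] -/
theorem mem_zmultiples_Tbar_of_forall_smul_eq (b : ℚ) [hE : (kubertTateFive b (1 : ℚ)).IsElliptic]
    {P : geomPoints (kubertTateFive b (1 : ℚ))} (hPfix : ∀ σ : absoluteGaloisGroup ℚ, σ • P = P)
    (hP : ((5 : ℕ) : ℤ) • P = 0) : P ∈ AddSubgroup.zmultiples (Tbar b (1 : ℚ)) := by
  haveI : Fact (Nat.Prime 5) := ⟨Nat.prime_five⟩
  set h5 := natCast_level_ne_zero ℚ 5 with hh5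
  have hT : ((5 : ℕ) : ℤ) • Tbar b (1 : ℚ) = 0 := five_zsmul_Tbar b 1
  obtain ⟨σ₀, hσ₀⟩ := exists_smul_eq_pow_two
  have hζ5 : weilPairingFun h5 P (Tbar b (1 : ℚ)) ^ 5 = 1 := weilPairingFun_pow h5 hP hT
  -- `ζ = e₅(P, T̄)` is fixed by `σ₀`, which squares fifth roots of unity: `ζ² = ζ`
  have hfix : σ₀ • weilPairingFun h5 P (Tbar b (1 : ℚ)) = weilPairingFun h5 P (Tbar b (1 : ℚ)) := by
    have h1 : weilPairingFun h5 (σ₀ • P) (σ₀ • Tbar b (1 : ℚ)) = σ₀ • weilPairingFun h5 P (Tbar b (1 : ℚ)) :=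
      weilPairingFun_smul h5 σ₀ hP hT
    rw [hPfix σ₀, smul_Tbar b (1 : ℚ) σ₀] at h1
    exact h1.symm
  have hζ0 : weilPairingFun h5 P (Tbar b (1 : ℚ)) ≠ 0 := fun h0 ↦ by
    rw [h0, zero_pow (by norm_num)] at hζ5
    exact zero_ne_one hζ5
  have h2 : weilPairingFun h5 P (Tbar b (1 : ℚ)) ^ 2 = weilPairingFun h5 P (Tbar b (1 : ℚ)) := by
    rw [← hσ₀ _ hζ5, hfix]
  have hζ1 : weilPairingFun h5 P (Tbar b (1 : ℚ)) = 1 :=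
    mul_left_cancel₀ hζ0 (by rw [← pow_two, h2, mul_one])
  exact mem_zmultiples_of_weilPairingFun_eq_one hT (Tbar_ne_zero b 1) hP hζ1

/-! ## §4 E-es-241 -/

/-- **PROOF OF ITEM E-es-241 `SplitFiveTorsionIsVeluQuotient`**: an elliptic curve over `ℚ` with a rational point
of order `5` and split `5`-torsion is `ℚ`-isomorphic to a Vélu quotient `veluFive b`.
[cite: SilvermanAEC2009, Prop. III.4.12, Thm. III.6.1–6.2, Prop. III.8.1] [cite: Knapp1993, §V.5 (5.31)]
[cite: Kubert1976, Table 3] [cite: Velu1971, formulae] -/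
theorem splitFiveTorsionIsVeluQuotient_holds : SplitFiveTorsionIsVeluQuotient := by
  intro W _ ht hsplit
  obtain ⟨t, ht5⟩ := ht
  haveI : Fact (Nat.Prime 5) := ⟨Nat.prime_five⟩
  -- the fixed kernel generator T̄ = ι t
  have hTord : addOrderOf (toGeomPoints W t) = 5 := by rw [addOrderOf_toGeomPoints_eq]; exact ht5
  have hT0 : toGeomPoints W t ≠ 0 := fun e ↦ by
    rw [e, addOrderOf_zero] at hTord; omega
  have hT5n : 5 • toGeomPoints W t = 0 := hTord ▸ addOrderOf_nsmul_eq_zero (toGeomPoints W t)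
  have hT : ((5 : ℕ) : ℤ) • toGeomPoints W t = 0 := by rw [natCast_zsmul]; exact hT5n
  have hTfix : ∀ σ : absoluteGaloisGroup ℚ, σ • toGeomPoints W t = toGeomPoints W t :=
    fun σ ↦ smul_toGeomPoints W σ t
  -- the split hypothesis, pointwise
  have hsplit' : ∀ σ : absoluteGaloisGroup ℚ, (∀ ζ : AlgebraicClosure ℚ, ζ ^ 5 = 1 → σ • ζ = ζ) →
      ∀ P : W.geomPoints, ((5 : ℕ) : ℤ) • P = 0 → σ • P = P := by
    intro σ hσ P hP
    have hmem : P ∈ W.geomTorsion 5 := (Submodule.mem_torsionBy_iff (5 : ℤ) P).mpr hP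
    exact congrArg Subtype.val (hsplit σ hσ ⟨P, hmem⟩)
  -- the stable complement C = ⟨U'⟩
  obtain ⟨U', hU'5, hU'0, hTnot, hstabU, hdecomp⟩ := exists_stable_complement hsplit' hT hT0 hTfix
  have hU'ord : addOrderOf U' = 5 :=
    addOrderOf_eq_prime (by rw [← natCast_zsmul]; exact hU'5) hU'0
  have hcardC : Nat.card (AddSubgroup.zmultiples U') = 5 := by rw [Nat.card_zmultiples, hU'ord]
  have hfin : (AddSubgroup.zmultiples U' : Set W.geomPoints).Finite := by
    haveI : Finite (AddSubgroup.zmultiples U') := Nat.finite_of_card_ne_zero (by rw [hcardC]; norm_num)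
    exact Set.toFinite _
  have hstab : ∀ (σ : absoluteGaloisGroup ℚ) (P : W.geomPoints), P ∈ AddSubgroup.zmultiples U' →
      σ • P ∈ AddSubgroup.zmultiples U' := by
    intro σ P hP
    obtain ⟨k, rfl⟩ := AddSubgroup.mem_zmultiples_iff.mp hP
    rw [smul_comm σ k U']
    exact AddSubgroup.zsmul_mem _ (hstabU σ) k
  -- the quotient E' = E/C with its dual
  obtain ⟨W', hW'e, g, f, hkerg, hfg, -⟩ :=
    exists_isogeny_ker_eq_and_comp_eq_nsmul_holds W (AddSubgroup.zmultiples U') hfin hstab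
  haveI : W'.IsElliptic := hW'e
  rw [hcardC] at hfg
  have hgTfix : ∀ σ : absoluteGaloisGroup ℚ, σ • g (toGeomPoints W t) = g (toGeomPoints W t) := by
    intro σ; rw [← Isogeny.map_smul, hTfix]
  have hgT0 : g (toGeomPoints W t) ≠ 0 := fun e ↦ hTnot (by
    rw [← hkerg]; exact (AddMonoidHom.mem_ker).mpr e)
  have hgT5 : 5 • g (toGeomPoints W t) = 0 := by rw [← map_nsmul, hT5n, map_zero]
  have hgTord : addOrderOf (g (toGeomPoints W t)) = 5 := addOrderOf_eq_prime hgT5 hgT0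
  -- ker f = ⟨g T̄⟩
  have hkerf : ∀ Q, f Q = 0 ↔ Q ∈ AddSubgroup.zmultiples (g (toGeomPoints W t)) := by
    intro Q
    constructor
    · intro hQ
      obtain ⟨P, rfl⟩ := g.surjective Q
      have hP5 : ((5 : ℕ) : ℤ) • P = 0 := by rw [natCast_zsmul, ← hfg P, hQ]
      obtain ⟨y, hy, c, rfl⟩ := hdecomp P hP5
      obtain ⟨k, rfl⟩ := AddSubgroup.mem_zmultiples_iff.mp hy
      have hgU : g U' = 0 := by
        have := (hkerg ▸ AddSubgroup.mem_zmultiples U' : U' ∈ g.toAddMonoidHom.ker)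
        exact (AddMonoidHom.mem_ker).mp this
      rw [map_add, map_zsmul, map_nsmul, hgU, smul_zero, add_zero]
      exact AddSubgroup.zsmul_mem _ (AddSubgroup.mem_zmultiples _) k
    · intro hQ
      obtain ⟨k, rfl⟩ := AddSubgroup.mem_zmultiples_iff.mp hQ
      rw [map_zsmul, hfg, hT5n, smul_zero]
  -- the rational point t' of order 5 on E'
  obtain ⟨t', ht'⟩ := exists_toGeomPoints_eq_of_forall_smul_eq W' hgTfix
  have ht'5 : addOrderOf t' = 5 := by
    rw [← addOrderOf_toGeomPoints_eq W' t', ht', hgTord]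
  -- Tate normal form of (E', t')
  obtain ⟨b, C₁, hC₁, h₀, hb0, -⟩ := exists_variableChange_eq_kubertTate_self_of_addOrderOf_eq_five' W' t' ht'5
  rw [← kubertTateFive_one_right] at hC₁
  haveI hKe : (kubertTateFive b (1 : ℚ)).IsElliptic := isElliptic_kubertTateFive_rat hb0 one_ne_zero
  have hW' : W' = C₁⁻¹ • kubertTateFive b (1 : ℚ) := by rw [← hC₁, inv_smul_smul]
  subst hW'
  -- transport of t' to E_{b,1}
  obtain ⟨P₀, hP₀⟩ := VariableChange.toIsogeny_surjective (kubertTateFive b (1 : ℚ)) C₁⁻¹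
    (toGeomPoints (C₁⁻¹ • kubertTateFive b (1 : ℚ)) t')
  have hinj := VariableChange.toIsogeny_injective (kubertTateFive b (1 : ℚ)) C₁⁻¹
  have hP₀fix : ∀ σ : absoluteGaloisGroup ℚ, σ • P₀ = P₀ := by
    intro σ
    apply hinj
    rw [Isogeny.map_smul, hP₀, ht', hgTfix]
  have hP₀ord : addOrderOf P₀ = 5 := by
    rw [← addOrderOf_injective (VariableChange.toIsogeny (kubertTateFive b (1 : ℚ)) C₁⁻¹).toAddMonoidHom hinj P₀,
      Isogeny.coe_toAddMonoidHom, hP₀, addOrderOf_toGeomPoints_eq, ht'5]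
  have hP₀5 : ((5 : ℕ) : ℤ) • P₀ = 0 := by
    rw [natCast_zsmul, ← hP₀ord]; exact addOrderOf_nsmul_eq_zero P₀
  have hP₀T : P₀ ∈ AddSubgroup.zmultiples (Tbar b (1 : ℚ)) :=
    mem_zmultiples_Tbar_of_forall_smul_eq b hP₀fix hP₀5
  have hzm : AddSubgroup.zmultiples P₀ = AddSubgroup.zmultiples (Tbar b (1 : ℚ)) := by
    have hle : AddSubgroup.zmultiples P₀ ≤ AddSubgroup.zmultiples (Tbar b (1 : ℚ)) :=
      AddSubgroup.zmultiples_le.mpr hP₀T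
    haveI : Finite (AddSubgroup.zmultiples (Tbar b (1 : ℚ))) :=
      Nat.finite_of_card_ne_zero (by rw [Nat.card_zmultiples, addOrderOf_Tbar]; norm_num)
    refine AddSubgroup.eq_of_le_of_card_ge hle ?_
    rw [Nat.card_zmultiples, Nat.card_zmultiples, hP₀ord, addOrderOf_Tbar]
  have hgT_eq : g (toGeomPoints W t) = VariableChange.toIsogeny (kubertTateFive b (1 : ℚ)) C₁⁻¹ P₀ := by
    rw [hP₀, ht']
  -- the kernels of f ∘ (E_{b,1} ≅ E') and of Vélu's φ_b agree
  have hker : ∀ P, (f.comp (VariableChange.toIsogeny (kubertTateFive b (1 : ℚ)) C₁⁻¹)) P = 0 ↔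
      fiveIsogeny b (1 : ℚ) P = 0 := by
    intro P
    have hR : fiveIsogeny b (1 : ℚ) P = 0 ↔ P ∈ AddSubgroup.zmultiples (Tbar b (1 : ℚ)) := by
      rw [← ker_fiveIsogeny_eq_zmultiples b (1 : ℚ), AddMonoidHom.mem_ker, Isogeny.coe_toAddMonoidHom]
    rw [hR, ← hzm, Isogeny.comp_apply, hkerf, hgT_eq]
    constructor
    · intro h
      obtain ⟨k, hk⟩ := AddSubgroup.mem_zmultiples_iff.mp h
      rw [← map_zsmul] at hk
      rw [← hinj hk]
      exact AddSubgroup.zsmul_mem _ (AddSubgroup.mem_zmultiples P₀) k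
    · intro h
      obtain ⟨k, rfl⟩ := AddSubgroup.mem_zmultiples_iff.mp h
      rw [map_zsmul]
      exact AddSubgroup.zsmul_mem _ (AddSubgroup.mem_zmultiples _) k
  obtain ⟨C, hC⟩ := Isogeny.exists_variableChange_eq_of_ker_eq
    (f.comp (VariableChange.toIsogeny (kubertTateFive b (1 : ℚ)) C₁⁻¹)) (fiveIsogeny b (1 : ℚ)) hker
  exact ⟨b, C, by rw [veluFive_eq_kubertTateFive']; exact hC⟩

end Summit.BirchSwinnertonDyer.BirchSwinnertonDyer.Theorems.ManinLocalTwoThree.ShimuraFive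

end
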